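import Literature.Probability.LatticeModels.LebowitzInequality
import HarnessLib

/-!
# Ellis–Monroe positivity with three clamped sites (box form), for the tooth `stub_condCubicNonpos`

Tooth `stub_boxSumNonpos` of line `Sketch` (card `amputated-lebowitz-vertex-measure`) of crux
stmt-CriticalPhenomena-4801 `PrecisionLaplacian.MoebiusLimitOfTwoPointLaw`; the companion file
`…CondCubicNonpos` turns it into the restricted-sum inequality `m(+,+,+) + m(+,-,-) ≤ m(+,+,-) + m(+,-,+)`
for conditional magnetisations (the four-site member `F4` of the VP¹ family).

Four replicas `c = (ξ, χ, ξ', χ')` of the spin system `ν_{Λ;K}` (`Kᵢ ≥ 0`, `|Cᵢ| ≤ 2`) are clamped at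
`(p, q, r)` to `ξ: (+,+,+)`, `χ: (+,-,-)`, `ξ': (+,+,-)`, `χ': (+,-,+)` ("the box"); there the rotated
variables of Glimm–Jaffe 1987, eq. (4.3.2), take the values `A_p = 4`, `C_q = 4`, `D_r = -4`, all other
rotated variables at `p, q, r` vanish. `∑_{c ∈ Box} B_g(c) w⁴(c) ≤ 0` follows by expanding the replicated weight
(Glimm–Jaffe 1987, Thm. 4.3.1) over the SIGN-TWISTED class `(-1)^{∑ₓ lₓ + ∑ₓ nₓ} ∏ₓ Aₓ^{kₓ}Bₓ^{lₓ}Cₓ^{mₓ}Dₓ^{nₓ}`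
(product-closed; contains `A_xA_y, B_xB_y, C_xC_y, D_xD_y, A_x, -B_g`), each member having a nonnegative box
sum: free sites have equal parities (sign symmetries), clamped sites contribute `4^k`, `4^m`, `(-1)^n(-4)^n`.
-/
noncomputable section

namespace Summit.CriticalPhenomena.Ising3DConformalLimit.PrecisionLaplacianMoebiusLimitOfTwoPointLaw

open Literature.Probability.LatticeModels Finset

section Box

variable {Λ : Type*} [Fintype Λ] [DecidableEq Λ]

/-- Indicator of `σ_p = 1, σ_q = s, σ_r = t` for one replica. -/
def clampInd (p q r : Λ) (s t : ℝ) (σ : SpinConfig Λ) : ℝ :=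
  if spinAt p σ = 1 ∧ spinAt q σ = s ∧ spinAt r σ = t then 1 else 0

/-- Indicator of the box: the four replicas `(ξ, χ, ξ', χ')` are clamped at `(p, q, r)` to
`(+,+,+)`, `(+,-,-)`, `(+,+,-)`, `(+,-,+)`. -/
def boxInd (p q r : Λ) (c : Cfg4 Λ) : ℝ :=
  clampInd p q r 1 1 c.1 * clampInd p q r (-1) (-1) c.2.1 *
    clampInd p q r 1 (-1) c.2.2.1 * clampInd p q r (-1) 1 c.2.2.2

omit [Fintype Λ] [DecidableEq Λ] in
/-- `clampInd ≥ 0`. -/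
theorem clampInd_nonneg (p q r : Λ) (s t : ℝ) (σ : SpinConfig Λ) : 0 ≤ clampInd p q r s t σ := by
  unfold clampInd; split_ifs <;> norm_num

omit [Fintype Λ] [DecidableEq Λ] in
/-- `boxInd ≥ 0`. -/
theorem boxInd_nonneg (p q r : Λ) (c : Cfg4 Λ) : 0 ≤ boxInd p q r c :=
  mul_nonneg (mul_nonneg (mul_nonneg (clampInd_nonneg _ _ _ _ _ _) (clampInd_nonneg _ _ _ _ _ _))
    (clampInd_nonneg _ _ _ _ _ _)) (clampInd_nonneg _ _ _ _ _ _)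

omit [Fintype Λ] [DecidableEq Λ] in
/-- On the box the twelve clamped spins have their prescribed values. -/
theorem spins_of_boxInd_ne_zero {p q r : Λ} {c : Cfg4 Λ} (h : boxInd p q r c ≠ 0) :
    (spinAt p c.1 = 1 ∧ spinAt q c.1 = 1 ∧ spinAt r c.1 = 1) ∧
    (spinAt p c.2.1 = 1 ∧ spinAt q c.2.1 = -1 ∧ spinAt r c.2.1 = -1) ∧
    (spinAt p c.2.2.1 = 1 ∧ spinAt q c.2.2.1 = 1 ∧ spinAt r c.2.2.1 = -1) ∧
    (spinAt p c.2.2.2 = 1 ∧ spinAt q c.2.2.2 = -1 ∧ spinAt r c.2.2.2 = 1) := by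
  unfold boxInd clampInd at h
  by_cases h1 : spinAt p c.1 = 1 ∧ spinAt q c.1 = 1 ∧ spinAt r c.1 = 1
  · by_cases h2 : spinAt p c.2.1 = 1 ∧ spinAt q c.2.1 = -1 ∧ spinAt r c.2.1 = -1
    · by_cases h3 : spinAt p c.2.2.1 = 1 ∧ spinAt q c.2.2.1 = 1 ∧ spinAt r c.2.2.1 = -1
      · by_cases h4 : spinAt p c.2.2.2 = 1 ∧ spinAt q c.2.2.2 = -1 ∧ spinAt r c.2.2.2 = 1
        · exact ⟨h1, h2, h3, h4⟩
        · exact absurd (by simp [h4]) h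
      · exact absurd (by simp [h3]) h
    · exact absurd (by simp [h2]) h
  · exact absurd (by simp [h1]) h

omit [Fintype Λ] [DecidableEq Λ] in
/-- The rotated variables at the clamped sites on the box: `(A, B, C, D)_p = (4, 0, 0, 0)`,
`(A, B, C, D)_q = (0, 0, 4, 0)`, `(A, B, C, D)_r = (0, 0, 0, -4)`. -/
theorem rep_of_boxInd_ne_zero {p q r : Λ} {c : Cfg4 Λ} (h : boxInd p q r c ≠ 0) :
    (repA p c = 4 ∧ repB p c = 0 ∧ repC p c = 0 ∧ repD p c = 0) ∧
    (repA q c = 0 ∧ repB q c = 0 ∧ repC q c = 4 ∧ repD q c = 0) ∧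
    (repA r c = 0 ∧ repB r c = 0 ∧ repC r c = 0 ∧ repD r c = -4) := by
  obtain ⟨⟨hp1, hq1, hr1⟩, ⟨hp2, hq2, hr2⟩, ⟨hp3, hq3, hr3⟩, ⟨hp4, hq4, hr4⟩⟩ :=
    spins_of_boxInd_ne_zero h
  simp only [repA, repB, repC, repD, hp1, hp2, hp3, hp4, hq1, hq2, hq3, hq4, hr1, hr2, hr3, hr4]
  norm_num

omit [Fintype Λ] [DecidableEq Λ] in
/-- `clampInd` only depends on the spins at `p, q, r`. -/
theorem clampInd_congr {p q r : Λ} {s t : ℝ} {σ τ : SpinConfig Λ} (hp : spinAt p σ = spinAt p τ)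
    (hq : spinAt q σ = spinAt q τ) (hr : spinAt r σ = spinAt r τ) :
    clampInd p q r s t σ = clampInd p q r s t τ := by simp only [clampInd, hp, hq, hr]

omit [Fintype Λ] [DecidableEq Λ] in
/-- `boxInd` only depends on the twelve spins at `p, q, r`. -/
theorem boxInd_congr {p q r : Λ} {c d : Cfg4 Λ}
    (h : ∀ y, y = p ∨ y = q ∨ y = r → spinAt y d.1 = spinAt y c.1 ∧ spinAt y d.2.1 = spinAt y c.2.1 ∧
      spinAt y d.2.2.1 = spinAt y c.2.2.1 ∧ spinAt y d.2.2.2 = spinAt y c.2.2.2) :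
    boxInd p q r d = boxInd p q r c := by
  obtain ⟨hp1, hp2, hp3, hp4⟩ := h p (Or.inl rfl)
  obtain ⟨hq1, hq2, hq3, hq4⟩ := h q (Or.inr (Or.inl rfl))
  obtain ⟨hr1, hr2, hr3, hr4⟩ := h r (Or.inr (Or.inr rfl))
  simp only [boxInd]
  rw [clampInd_congr hp1 hq1 hr1, clampInd_congr hp2 hq2 hr2, clampInd_congr hp3 hq3 hr3,
    clampInd_congr hp4 hq4 hr4]

omit [Fintype Λ] in
/-- `boxInd` is invariant under `repNeg x`, `repSwap₁ x`, `repSwap₂ x` for a free site `x`. -/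
theorem boxInd_rep_free {p q r x : Λ} (hp : x ≠ p) (hq : x ≠ q) (hr : x ≠ r) (c : Cfg4 Λ) :
    boxInd p q r (repNeg x c) = boxInd p q r c ∧ boxInd p q r (repSwap₁ x c) = boxInd p q r c ∧
      boxInd p q r (repSwap₂ x c) = boxInd p q r c := by
  have hne : ∀ y, y = p ∨ y = q ∨ y = r → y ≠ x := by
    rintro y (rfl | rfl | rfl) <;> [exact hp.symm; exact hq.symm; exact hr.symm]
  have hf : ∀ (σ : SpinConfig Λ) (y : Λ), y ≠ x → spinAt y (flipOn {x} σ) = spinAt y σ := fun σ y hy => by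
    rw [spinAt_flipOn, if_neg (by simpa using hy)]
  have hm : ∀ (σ τ : SpinConfig Λ) (y : Λ), y ≠ x → spinAt y (mixAt x σ τ) = spinAt y σ := fun σ τ y hy => by
    rw [spinAt_mixAt, if_neg hy]
  refine ⟨boxInd_congr fun y hy => ?_, boxInd_congr fun y hy => ?_, boxInd_congr fun y hy => ?_⟩
  · exact ⟨hf _ _ (hne y hy), hf _ _ (hne y hy), hf _ _ (hne y hy), hf _ _ (hne y hy)⟩
  · exact ⟨hm _ _ _ (hne y hy), hm _ _ _ (hne y hy), hm _ _ _ (hne y hy), hm _ _ _ (hne y hy)⟩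
  · exact ⟨hm _ _ _ (hne y hy), hm _ _ _ (hne y hy), hm _ _ _ (hne y hy), hm _ _ _ (hne y hy)⟩
/-! ### The sign-twisted monomial class -/

/-- The sign-twisted monomial `(-1)^{∑ₓ lₓ + ∑ₓ nₓ} ∏ₓ Aₓ^{kₓ} Bₓ^{lₓ} Cₓ^{mₓ} Dₓ^{nₓ}`. -/
def signedRepMonomial (k l m n : Λ → ℕ) (c : Cfg4 Λ) : ℝ :=
  (-1) ^ (∑ x, l x + ∑ x, n x) * repMonomial k l m n c

/-- The class of sign-twisted monomials. -/
def signedRepClass : Set (Cfg4 Λ → ℝ) :=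
  {M | ∃ k l m n : Λ → ℕ, M = signedRepMonomial k l m n}

omit [DecidableEq Λ] in
/-- The sign-twisted class contains `1` and is closed under products. -/
theorem signedRepClass_one_mem_mul_mem :
    (fun _ => (1 : ℝ)) ∈ (signedRepClass : Set (Cfg4 Λ → ℝ)) ∧
      ∀ M ∈ (signedRepClass : Set (Cfg4 Λ → ℝ)), ∀ N ∈ signedRepClass, M * N ∈ signedRepClass := by
  refine ⟨⟨0, 0, 0, 0, by funext c; simp [signedRepMonomial, repMonomial]⟩, ?_⟩
  rintro _ ⟨k, l, m, n, rfl⟩ _ ⟨k', l', m', n', rfl⟩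
  refine ⟨k + k', l + l', m + m', n + n', ?_⟩
  funext c
  have hmul := congrFun (repMonomial_mul (Λ := Λ) k l m n k' l' m' n') c
  simp only [Pi.mul_apply] at hmul
  simp only [Pi.mul_apply, signedRepMonomial, Pi.add_apply, Finset.sum_add_distrib]
  rw [← hmul]
  have hs : ((-1 : ℝ)) ^ (∑ x, l x + ∑ x, l' x + (∑ x, n x + ∑ x, n' x)) =
      (-1) ^ (∑ x, l x + ∑ x, n x) * (-1) ^ (∑ x, l' x + ∑ x, n' x) := by
    rw [← pow_add]; congr 1; ring
  rw [hs]; ring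

/-- `A_x`, `C_x`, `-B_x`, `-D_x` are in the class. -/
theorem rep_mem_signedRepClass (x : Λ) :
    repA x ∈ (signedRepClass : Set (Cfg4 Λ → ℝ)) ∧ repC x ∈ (signedRepClass : Set (Cfg4 Λ → ℝ)) ∧
      -repB x ∈ (signedRepClass : Set (Cfg4 Λ → ℝ)) ∧ -repD x ∈ (signedRepClass : Set (Cfg4 Λ → ℝ)) := by
  refine ⟨⟨fun y => if y = x then 1 else 0, 0, 0, 0, ?_⟩, ⟨0, 0, fun y => if y = x then 1 else 0, 0, ?_⟩,
    ⟨0, fun y => if y = x then 1 else 0, 0, 0, ?_⟩, ⟨0, 0, 0, fun y => if y = x then 1 else 0, ?_⟩⟩ <;>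
  funext c <;>
  simp [signedRepMonomial, repMonomial, pow_ite, Finset.prod_ite_eq', Finset.sum_ite_eq']

/-- `A_xA_y`, `B_xB_y = (-B_x)(-B_y)`, `C_xC_y`, `D_xD_y = (-D_x)(-D_y)` are in the class. -/
theorem repPair_mem_signedRepClass (x y : Λ) :
    repA x * repA y ∈ (signedRepClass : Set (Cfg4 Λ → ℝ)) ∧ repB x * repB y ∈ (signedRepClass : Set (Cfg4 Λ → ℝ)) ∧
      repC x * repC y ∈ (signedRepClass : Set (Cfg4 Λ → ℝ)) ∧ repD x * repD y ∈ (signedRepClass : Set (Cfg4 Λ → ℝ)) := by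
  have hmul := (signedRepClass_one_mem_mul_mem (Λ := Λ)).2
  obtain ⟨hA, hC, hB, hD⟩ := rep_mem_signedRepClass (Λ := Λ) x
  obtain ⟨hA', hC', hB', hD'⟩ := rep_mem_signedRepClass (Λ := Λ) y
  refine ⟨hmul _ hA _ hA', ?_, hmul _ hC _ hC', ?_⟩
  · have h := hmul _ hB _ hB'; rwa [neg_mul_neg] at h
  · have h := hmul _ hD _ hD'; rwa [neg_mul_neg] at h

/-! ### Positivity of the box sums of twisted monomials (no interaction) -/

/-- The a-priori box sum of a sign-twisted monomial is nonnegative. -/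
theorem sum_signedRepMonomial_mul_boxInd_nonneg (p q r : Λ) (k l m n : Λ → ℕ) :
    0 ≤ ∑ c : Cfg4 Λ, signedRepMonomial k l m n c * boxInd p q r c := by
  -- a free site with a parity defect makes the sum vanish
  by_cases h1 : ∃ x, x ≠ p ∧ x ≠ q ∧ x ≠ r ∧ Odd (k x + l x + m x + n x)
  · obtain ⟨x, hxp, hxq, hxr, hodd⟩ := h1
    rw [sum_cfg4_eq_zero_of_odd (repNeg_involutive x) _ fun c => by
      rw [signedRepMonomial, repMonomial_repNeg, (boxInd_rep_free hxp hxq hxr c).1, hodd.neg_one_pow,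
        signedRepMonomial]; ring]
  by_cases h2 : ∃ x, x ≠ p ∧ x ≠ q ∧ x ≠ r ∧ Odd (m x + n x)
  · obtain ⟨x, hxp, hxq, hxr, hodd⟩ := h2
    rw [sum_cfg4_eq_zero_of_odd (repSwap₁_involutive x) _ fun c => by
      rw [signedRepMonomial, repMonomial_repSwap₁, (boxInd_rep_free hxp hxq hxr c).2.1, hodd.neg_one_pow,
        signedRepMonomial]; ring]
  by_cases h3 : ∃ x, x ≠ p ∧ x ≠ q ∧ x ≠ r ∧ Odd (l x + n x)
  · obtain ⟨x, hxp, hxq, hxr, hodd⟩ := h3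
    rw [sum_cfg4_eq_zero_of_odd (repSwap₂_involutive x) _ fun c => by
      rw [signedRepMonomial, repMonomial_repSwap₂, (boxInd_rep_free hxp hxq hxr c).2.2, hodd.neg_one_pow,
        signedRepMonomial]; ring]
  push Not at h1 h2 h3
  refine Finset.sum_nonneg fun c _ => ?_
  by_cases hbox : boxInd p q r c = 0
  · rw [hbox, mul_zero]
  refine mul_nonneg ?_ (boxInd_nonneg p q r c)
  obtain ⟨⟨hAp, hBp, hCp, hDp⟩, ⟨hAq, hBq, hCq, hDq⟩, ⟨hAr, hBr, hCr, hDr⟩⟩ := rep_of_boxInd_ne_zero hbox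
  -- distribute the sign over the sites
  have hsign : ((-1 : ℝ)) ^ (∑ x, l x + ∑ x, n x) = ∏ x, (-1 : ℝ) ^ (l x + n x) := by
    rw [← Finset.sum_add_distrib, Finset.prod_pow_eq_pow_sum]
  rw [signedRepMonomial, hsign, repMonomial, ← Finset.prod_mul_distrib]
  refine Finset.prod_nonneg fun x _ => ?_
  -- the clamped sites
  by_cases hxp : x = p
  · subst hxp
    rw [hAp, hBp, hCp, hDp]
    by_cases hl : l x = 0
    · by_cases hm : m x = 0
      · by_cases hn : n x = 0
        · simp only [hl, hm, hn, pow_zero, mul_one, add_zero, one_mul]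
          positivity
        · simp [zero_pow hn]
      · simp [zero_pow hm]
    · simp [zero_pow hl]
  by_cases hxq : x = q
  · subst hxq
    rw [hAq, hBq, hCq, hDq]
    by_cases hk : k x = 0
    · by_cases hl : l x = 0
      · by_cases hn : n x = 0
        · simp only [hk, hl, hn, pow_zero, mul_one, add_zero, one_mul]
          positivity
        · simp [zero_pow hn]
      · simp [zero_pow hl]
    · simp [zero_pow hk]
  by_cases hxr : x = r
  · subst hxr
    rw [hAr, hBr, hCr, hDr]
    by_cases hk : k x = 0
    · by_cases hl : l x = 0
      · by_cases hm : m x = 0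
        · simp only [hk, hl, hm, pow_zero, one_mul, zero_add]
          rw [← mul_pow]
          norm_num
        · simp [zero_pow hm]
      · simp [zero_pow hl]
    · simp [zero_pow hk]
  -- a free site: all four exponents have the same parity
  have e1 : Even (k x + l x + m x + n x) := Nat.not_odd_iff_even.1 (h1 x hxp hxq hxr)
  have e2 : Even (m x + n x) := Nat.not_odd_iff_even.1 (h2 x hxp hxq hxr)
  have e3 : Even (l x + n x) := Nat.not_odd_iff_even.1 (h3 x hxp hxq hxr)
  rw [e3.neg_one_pow, one_mul]
  rcases Nat.even_or_odd (n x) with hn | hn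
  · have hl : Even (l x) := by
      rcases Nat.even_or_odd (l x) with h' | h'
      · exact h'
      · exact absurd e3 (Nat.not_even_iff_odd.2 (h'.add_even hn))
    have hm : Even (m x) := by
      rcases Nat.even_or_odd (m x) with h' | h'
      · exact h'
      · exact absurd e2 (Nat.not_even_iff_odd.2 (h'.add_even hn))
    have hk : Even (k x) := by
      rcases Nat.even_or_odd (k x) with h' | h'
      · exact h'
      · exact absurd e1 (Nat.not_even_iff_odd.2 (((h'.add_even hl).add_even hm).add_even hn))
    exact mul_nonneg (mul_nonneg (mul_nonneg (hk.pow_nonneg _) (hl.pow_nonneg _)) (hm.pow_nonneg _))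
      (hn.pow_nonneg _)
  · have hl : Odd (l x) := by
      rcases Nat.even_or_odd (l x) with h' | h'
      · exact absurd e3 (Nat.not_even_iff_odd.2 (h'.add_odd hn))
      · exact h'
    have hm : Odd (m x) := by
      rcases Nat.even_or_odd (m x) with h' | h'
      · exact absurd e2 (Nat.not_even_iff_odd.2 (h'.add_odd hn))
      · exact h'
    have hk : Odd (k x) := by
      rcases Nat.even_or_odd (k x) with h' | h'
      · exact absurd e1 (Nat.not_even_iff_odd.2 (((h'.add_odd hl).add_odd hm).add_odd hn))
      · exact h'
    obtain ⟨k', hk'⟩ := hk; obtain ⟨l', hl'⟩ := hl; obtain ⟨m', hm'⟩ := hm; obtain ⟨n', hn'⟩ := hn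
    rw [hk', hl', hm', hn']
    have h := repA_mul_repB_mul_repC_mul_repD_nonneg x c
    calc (0 : ℝ) ≤ (repA x c * repB x c * repC x c * repD x c) *
          ((repA x c ^ 2) ^ k' * (repB x c ^ 2) ^ l' * (repC x c ^ 2) ^ m' * (repD x c ^ 2) ^ n') :=
          mul_nonneg h (by positivity)
      _ = repA x c ^ (2 * k' + 1) * repB x c ^ (2 * l' + 1) * repC x c ^ (2 * m' + 1) *
          repD x c ^ (2 * n' + 1) := by ring

/-- `∑_c M(c) boxInd(c) ≥ 0` for every member of the sign-twisted class. -/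
theorem sum_signedRepClass_mul_boxInd_nonneg (p q r : Λ) :
    ∀ M ∈ (signedRepClass : Set (Cfg4 Λ → ℝ)), 0 ≤ ∑ c, M c * boxInd p q r c := by
  rintro _ ⟨k, l, m, n, rfl⟩
  exact sum_signedRepMonomial_mul_boxInd_nonneg p q r k l m n

/-! ### The interaction: Ellis–Monroe expansion over the twisted class -/

variable {ι : Type*} (s : Finset ι) (K : ι → ℝ) (C : ι → Finset Λ)

/-- **The replicated Gibbs weight restricted to the box is positive on the twisted class**: for
`Kᵢ ≥ 0` on supports of at most two sites, `∑_c M(c) w(ξ)w(χ)w(ξ')w(χ') boxInd(c) ≥ 0` for every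
member `M` of the sign-twisted class (each interaction term `K (A A + B B + C C + D D)/4`, resp. `K A`, is
a nonnegative combination of members of the class; induction on the interaction set). -/
theorem sum_signedRepClass_mul_gksWeight4_mul_boxInd_nonneg (p q r : Λ)
    (hK : ∀ i ∈ s, 0 ≤ K i) (hC : ∀ i ∈ s, (C i).card ≤ 2) :
    ∀ M ∈ (signedRepClass : Set (Cfg4 Λ → ℝ)), 0 ≤ ∑ c, M c * (gksWeight4 s K C c * boxInd p q r c) := by
  classical
  have hmul := (signedRepClass_one_mem_mul_mem (Λ := Λ)).2
  -- one interaction term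
  have step : ∀ {Kc : ℝ}, 0 ≤ Kc → ∀ {A : Finset Λ}, A.card ≤ 2 → ∀ {W : Cfg4 Λ → ℝ},
      (∀ M ∈ (signedRepClass : Set (Cfg4 Λ → ℝ)), 0 ≤ ∑ c, M c * W c) →
      ∀ M ∈ (signedRepClass : Set (Cfg4 Λ → ℝ)), 0 ≤ ∑ c, M c * (Real.exp (Kc * quadSum A c) * W c) := by
    intro Kc hKc A hA W hW
    have hcases : A.card = 0 ∨ A.card = 1 ∨ A.card = 2 := by omega
    rcases hcases with h0 | h1 | h2
    · rw [Finset.card_eq_zero] at h0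
      subst h0
      intro M hM
      have h : ∑ c, M c * (Real.exp (Kc * quadSum ∅ c) * W c) = Real.exp (Kc * 4) * ∑ c, M c * W c := by
        rw [Finset.mul_sum]
        refine Finset.sum_congr rfl fun c _ => ?_
        simp only [quadSum, spinProduct_empty]
        ring_nf
      rw [h]
      exact mul_nonneg (Real.exp_pos _).le (hW M hM)
    · obtain ⟨x, rfl⟩ := Finset.card_eq_one.1 h1
      simp_rw [quadSum_singleton]
      exact classExp_step hmul hW hKc (rep_mem_signedRepClass x).1
    · obtain ⟨x, y, hxy, rfl⟩ := Finset.card_eq_two.1 h2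
      simp_rw [quadSum_pair hxy]
      intro M hM
      have h4 : (0 : ℝ) ≤ Kc * 4⁻¹ := by positivity
      obtain ⟨pA, pB, pC, pD⟩ := repPair_mem_signedRepClass (Λ := Λ) x y
      have e1 := classExp_step hmul hW h4 pD
      have e2 := classExp_step hmul e1 h4 pC
      have e3 := classExp_step hmul e2 h4 pB
      have e4 := classExp_step hmul e3 h4 pA M hM
      have hexp : ∀ c : Cfg4 Λ, Real.exp (Kc * (4⁻¹ * (repA x c * repA y c) +
          4⁻¹ * (repB x c * repB y c) + 4⁻¹ * (repC x c * repC y c) + 4⁻¹ * (repD x c * repD y c))) * W c =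
          Real.exp (Kc * 4⁻¹ * (repA x * repA y) c) * (Real.exp (Kc * 4⁻¹ * (repB x * repB y) c) *
            (Real.exp (Kc * 4⁻¹ * (repC x * repC y) c) *
              (Real.exp (Kc * 4⁻¹ * (repD x * repD y) c) * W c))) := by
        intro c
        simp only [Pi.mul_apply]
        rw [show Kc * (4⁻¹ * (repA x c * repA y c) + 4⁻¹ * (repB x c * repB y c) +
            4⁻¹ * (repC x c * repC y c) + 4⁻¹ * (repD x c * repD y c)) =
            Kc * 4⁻¹ * (repA x c * repA y c) + (Kc * 4⁻¹ * (repB x c * repB y c) +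
              (Kc * 4⁻¹ * (repC x c * repC y c) + Kc * 4⁻¹ * (repD x c * repD y c))) by ring,
          Real.exp_add, Real.exp_add, Real.exp_add]
        ring
      simp_rw [hexp]
      exact e4
  simp_rw [gksWeight4_eq_exp]
  induction s using Finset.induction_on with
  | empty =>
    intro M hM
    simpa using sum_signedRepClass_mul_boxInd_nonneg p q r M hM
  | insert j s hj ih =>
    have ih' := ih (fun i hi => hK i (Finset.mem_insert_of_mem hi))
      (fun i hi => hC i (Finset.mem_insert_of_mem hi))
    have h := step (hK j (Finset.mem_insert_self j s)) (hC j (Finset.mem_insert_self j s)) ih'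
    intro M hM
    have hexp : ∀ c : Cfg4 Λ, Real.exp (∑ i ∈ insert j s, K i * quadSum (C i) c) * boxInd p q r c =
        Real.exp (K j * quadSum (C j) c) *
          (Real.exp (∑ i ∈ s, K i * quadSum (C i) c) * boxInd p q r c) := by
      intro c
      rw [Finset.sum_insert hj, Real.exp_add, mul_assoc]
    simp_rw [hexp]
    exact h M hM

/-- **Box form of the inequality**: `∑_{c ∈ Box} B_g(c) w(ξ)w(χ)w(ξ')w(χ') ≤ 0`. -/
theorem sum_boxInd_mul_repB_mul_gksWeight4_nonpos (g p q r : Λ)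
    (hK : ∀ i ∈ s, 0 ≤ K i) (hC : ∀ i ∈ s, (C i).card ≤ 2) :
    ∑ c, boxInd p q r c * repB g c * gksWeight4 s K C c ≤ 0 := by
  have h := sum_signedRepClass_mul_gksWeight4_mul_boxInd_nonneg s K C p q r hK hC (-repB g)
    (rep_mem_signedRepClass g).2.2.1
  have e : ∑ c, (-repB g) c * (gksWeight4 s K C c * boxInd p q r c) =
      -∑ c, boxInd p q r c * repB g c * gksWeight4 s K C c := by
    rw [← Finset.sum_neg_distrib]; exact Finset.sum_congr rfl fun c _ => by simp only [Pi.neg_apply]; ring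
  linarith [e ▸ h]

end Box

/-- **Tooth `stub_boxSumNonpos` (box form of `stub_condCubicNonpos`).** For the spin system `ν_{Λ;K}`
on `Fin n` with couplings `Kᵢ ≥ 0` on supports of at most two sites and sites `g p q r`: the sum over the
four replicas clamped at `(p, q, r)` to `(+,+,+)`, `(+,-,-)`, `(+,+,-)`, `(+,-,+)` of
`(ξ_g + χ_g - ξ'_g - χ'_g) w(ξ)w(χ)w(ξ')w(χ')` is `≤ 0`. -/
theorem stub_boxSumNonpos :
    ∀ (n m : ℕ) (K : Fin m → ℝ) (C : Fin m → Finset (Fin n)), (∀ i, 0 ≤ K i) → (∀ i, (C i).card ≤ 2) →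
      ∀ g p q r : Fin n,
        ∑ c : Cfg4 (Fin n),
          ((if spinAt p c.1 = 1 ∧ spinAt q c.1 = 1 ∧ spinAt r c.1 = 1 then (1 : ℝ) else 0) *
            (if spinAt p c.2.1 = 1 ∧ spinAt q c.2.1 = -1 ∧ spinAt r c.2.1 = -1 then (1 : ℝ) else 0) *
            (if spinAt p c.2.2.1 = 1 ∧ spinAt q c.2.2.1 = 1 ∧ spinAt r c.2.2.1 = -1 then (1 : ℝ) else 0) *
            (if spinAt p c.2.2.2 = 1 ∧ spinAt q c.2.2.2 = -1 ∧ spinAt r c.2.2.2 = 1 then (1 : ℝ) else 0)) *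
          (spinAt g c.1 + spinAt g c.2.1 - spinAt g c.2.2.1 - spinAt g c.2.2.2) *
          gksWeight4 Finset.univ K C c ≤ 0 := by
  intro n m K C hK hC g p q r
  exact sum_boxInd_mul_repB_mul_gksWeight4_nonpos Finset.univ K C g p q r (fun i _ => hK i) (fun i _ => hC i)

end Summit.CriticalPhenomena.Ising3DConformalLimit.PrecisionLaplacianMoebiusLimitOfTwoPointLaw

end
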